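import Mathlib
import Literature.MathematicalPhysics.QuantumFieldTheory.YangMillsOS
import Literature.MathematicalPhysics.QuantumFieldTheory.SpeciesLatticeProducts
import Literature.MathematicalPhysics.QuantumFieldTheory.LatticeGaugeProofs
import HarnessLib

/-!
# Line `Sketch` (holomorphic coupling response) of crux `HypercubicLimit` — stub 2.3:
# the covariance IS the truncated lattice two-point function

Support file for crux `stmt-QuantumFields-16154` (`CoincidenceRotationBootstrap.HypercubicLimit` =
`MirrorModularBoosts.WeakCouplingHypercubicLimit`), line `Sketch` (card `holomorphic-coupling-response`),
registered stub `stub_covBookkeeping` of `Cruxes/HypercubicLimit/Lines/Sketch.lean`.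

With `μ_k = wilsonMeasure r.ρ (sch.β k)` the Wilson measure of the scheme at step `k` on the torus of side
`sch.side k = 2 L_k + 1` (a probability measure, `isProbabilityMeasure_wilsonMeasure`) and
`Φ_k(f) U = smearedLatticeField r.curvature.F (box 4 L_k) a_k c_k m_k f (torusLift (sch.side k) U)` the
smeared renormalised curvature field (bounded and measurable in the torus configuration), the covariance
`Cov_{μ_k}(Φ_k(f₀), Φ_k(f₁))` is the truncated two-point function
`𝔖₂^{curv,curv}(f₀ ⊗ f₁) − 𝔖₁^{curv}(f₀) 𝔖₁^{curv}(f₁)` of the statement's `latticeSchwinger` for the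
constant species string `curvature`.

Proof: pure bookkeeping — Mathlib's `covariance_eq_sub` (`Cov(X, Y) = E[XY] − E[X] E[Y]` for
`MemLp 2` variables under a probability measure; bounded measurable functions are `MemLp 2` by
`MemLp.of_bound`), then `latticeSchwinger` at `n = 2` is `∫ Φ₀ Φ₁ dμ_k` (`Fin.prod_univ_two`) and at
`n = 1` is `∫ Φᵢ dμ_k` (`Fin.prod_univ_one`).

* `covBookkeeping_covariance_eq_of_abs_le` — the abstract statement on a probability space
  (private helper);
* `stub_covBookkeeping` — the registered stub (tree vocabulary).
-/

noncomputable section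

open scoped SchwartzMap
open MeasureTheory ProbabilityTheory Filter Topology
open Literature.MathematicalPhysics.QuantumLattice Literature.MathematicalPhysics.QuantumFieldTheory

namespace Summit.QuantumFields.YangMills.Cruxes.HypercubicLimit.CouplingResponse

/-- **`Cov(X, Y) = E[XY] − E[X] E[Y]` for bounded measurable variables** on a probability space
(Mathlib's `covariance_eq_sub`; bounded measurable functions are `MemLp 2` by `MemLp.of_bound`),
with the product integrand written pointwise. [folklore] -/
private theorem covBookkeeping_covariance_eq_of_abs_le {Ω : Type*} {mΩ : MeasurableSpace Ω}
    {μ : Measure Ω} [IsProbabilityMeasure μ] {X Y : Ω → ℝ} (hX : Measurable X) (hY : Measurable Y)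
    {C B : ℝ} (hC : ∀ ω, |X ω| ≤ C) (hB : ∀ ω, |Y ω| ≤ B) :
    cov[X, Y; μ] = (∫ ω, X ω * Y ω ∂μ) - (∫ ω, X ω ∂μ) * ∫ ω, Y ω ∂μ := by
  have hX2 : MemLp X 2 μ := MemLp.of_bound hX.aestronglyMeasurable C
    (ae_of_all _ fun ω => by rw [Real.norm_eq_abs]; exact hC ω)
  have hY2 : MemLp Y 2 μ := MemLp.of_bound hY.aestronglyMeasurable B
    (ae_of_all _ fun ω => by rw [Real.norm_eq_abs]; exact hB ω)
  rw [covariance_eq_sub hX2 hY2]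
  simp only [Pi.mul_apply]

/-- **Stub 2.3 of line `Sketch` — bookkeeping: the covariance IS the truncated lattice two-point
function.**  For the smeared renormalised curvature fields `Φ_k(f₀)`, `Φ_k(f₁)` at step `k` of the scheme
under the Wilson measure `μ_k = wilsonMeasure r.ρ (sch.β k)` (a probability measure,
`isProbabilityMeasure_wilsonMeasure`), `Cov_{μ_k}(Φ_k(f₀), Φ_k(f₁)) = 𝔖₂(f₀ ⊗ f₁) − 𝔖₁(f₀) 𝔖₁(f₁)` with
`𝔖ₙ` the statement's `latticeSchwinger` for the constant species string `curvature`: the fields are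
measurable (`measurable_smearedLatticeField_torusLift`) and bounded (`exists_bound_smearedLatticeField`,
the curvature species being a bounded observable), so `covariance = E[XY] − E[X] E[Y]`
(`covariance_eq_sub`), and the `n = 2`, `n = 1` lattice functions are `∫ Φ₀ Φ₁ dμ_k`, `∫ Φᵢ dμ_k`
(`Fin.prod_univ_two`, `Fin.prod_univ_one`). [folklore] -/
theorem stub_covBookkeeping :
    ∀ (G : Type) [Group G] [TopologicalSpace G] [IsTopologicalGroup G] [CompactSpace G]
      [MeasurableSpace G] [BorelSpace G] (r : LatticeRep G) (sch : SpeciesScheme (YMSpecies G))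
      (k : ℕ) (f₀ f₁ : 𝓢(EuclideanSpace ℝ (Fin 4), ℝ)),
      covariance
          (fun U => smearedLatticeField r.curvature.F
            (Literature.Probability.LatticeModels.box 4 (sch.L k)) (sch.a k) (sch.c r.curvature k)
            (sch.m r.curvature k) f₀ (torusLift (sch.side k) U))
          (fun U => smearedLatticeField r.curvature.F
            (Literature.Probability.LatticeModels.box 4 (sch.L k)) (sch.a k) (sch.c r.curvature k)
            (sch.m r.curvature k) f₁ (torusLift (sch.side k) U))
          (wilsonMeasure r.ρ (sch.β k) : Measure (GaugeConfig 4 (sch.side k) G)) =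
        latticeSchwinger r.ρ sch (fun s => s.F) k 2 (fun _ => r.curvature) ![f₀, f₁] -
          latticeSchwinger r.ρ sch (fun s => s.F) k 1 (fun _ => r.curvature) ![f₀] *
            latticeSchwinger r.ρ sch (fun s => s.F) k 1 (fun _ => r.curvature) ![f₁] := by
  intro G _ _ _ _ _ _ r sch k f₀ f₁
  haveI : IsProbabilityMeasure (wilsonMeasure (d := 4) (L := sch.side k) (G := G) r.ρ (sch.β k)) :=
    isProbabilityMeasure_wilsonMeasure r.ρ r.continuous (sch.β k)
  obtain ⟨C, hC⟩ := exists_bound_smearedLatticeField r.curvature.bounded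
    (Literature.Probability.LatticeModels.box 4 (sch.L k)) (sch.a k) (sch.c r.curvature k)
    (sch.m r.curvature k) f₀
  obtain ⟨B, hB⟩ := exists_bound_smearedLatticeField r.curvature.bounded
    (Literature.Probability.LatticeModels.box 4 (sch.L k)) (sch.a k) (sch.c r.curvature k)
    (sch.m r.curvature k) f₁
  rw [covBookkeeping_covariance_eq_of_abs_le
    (measurable_smearedLatticeField_torusLift r.curvature _ _ _ _ f₀ (sch.side k))
    (measurable_smearedLatticeField_torusLift r.curvature _ _ _ _ f₁ (sch.side k))
    (fun U => hC _) (fun U => hB _)]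
  simp only [latticeSchwinger, Fin.prod_univ_two, Fin.prod_univ_one, Matrix.cons_val_zero,
    Matrix.cons_val_one, Matrix.cons_val_fin_one]

end Summit.QuantumFields.YangMills.Cruxes.HypercubicLimit.CouplingResponse

end
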